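import Summits.QuantumAdvantage.QuantumAdvantage.Theorems.CubicForrelationNearExactIsExactDerivDegree
import Summits.QuantumAdvantage.QuantumAdvantage.Theorems.CubicForrelationNearExactIsExactRankTwoCeilingA

/-!
# Crux `CubicForrelation.NearExactIsExact` (stmt-QuantumAdvantage-14043) — the rank-2 perturbation ceiling

Line `direct-sum-amplification`, helper stub `ar_rankTwoCeiling` (tag AR2), a theorem extending the KNOWN branch of
the crux beyond Maiorana–McFarland shape. Let `n = m + m` and let `(d, g)` be an EXACT cubic pair in dual form,
`W_g(x) = 2^m (-1)^{d(x)}` (`g` bent with cubic dual `d`). Perturb `g` by any quadratic of symplectic rank `≤ 2`,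
`p = ℓ₁ℓ₂ ⊕ ℓ₃` with `ℓ₁ ℓ₂ ℓ₃` affine. Then against EVERY cubic `f`:

  `Φ(f, g ⊕ p) = 1 ∨ Φ(f, g ⊕ p) ≤ 31/32`.

(`g ⊕ ℓ₁ℓ₂` need not be bent nor Maiorana–McFarland shaped, so this is outside the landed MM ceiling
`stub_mmFormCeiling`; numerically the values at `n = 8` are exactly `{1, 3/4, 1/2}`, the bound `31/32` is what the
degree argument gives uniformly in `n`.)

The whole proof is in the companion file `CubicForrelationNearExactIsExactRankTwoCeilingA.lean`
(`ar_rankTwoCeiling_of_derivDegree`, stated from the "derivatives lower the degree" statement of stub D as a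
hypothesis): sign forms of affine functions, the four-character form of `(-1)^{ℓ₁ℓ₂ ⊕ ℓ₃}`, translate duality
`W_{g ⊕ p} = 2^m S/2` with `S = Σ_{i<4} (-1)^{bᵢ ⊕ d(x ⊕ vᵢ)}`, Parseval `Σ S² = 4·2ⁿ`, and a counting argument with
the Reed–Muller minimum weight (`stub_rmWeight`) on the coincidence set `{e₀ = e₁ = e₂ = e₃}` and on the word
`f ⊕ maj(e₀, e₁, e₂)`, both of degree `≤ 6`. Here the hypothesis is discharged with the landed `stub_derivDegree`.

Sources: S. Aaronson, A. Ambainis, Forrelation, SIAM J. Comput. 47 (2018) §1.1.1; O. Rothaus, On "bent" functions,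
JCTA 20 (1976); F. J. MacWilliams, N. J. A. Sloane, The Theory of Error-Correcting Codes (1977) Ch. 13 — orientation
only; everything is proved in the tree, axioms standard. Imports: landed `Theorems` helper modules of this line only
(never the Theses file).
-/

set_option linter.dupNamespace false -- D-0017: single-problem summit

namespace Summit.QuantumAdvantage.QuantumAdvantage.Theorems.CubicForrelation.NearExactIsExact

open Finset
open Literature.Computability.QuantumComplexity
open Literature.Computability.QuantumComplexity.BuzetChailloux (bxor zeroVec signOf_sq)
open Literature.Computability.QuantumComplexity.DerivativeWalsh (W)

/-- **Rank-2 perturbation ceiling** (helper stub `ar_rankTwoCeiling`, line `direct-sum-amplification`). For every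
cubic `f`, every exact cubic pair `(d, g)` on `m + m` bits in dual form `W_g = 2^m (-1)^d`, and any three affine
functions `ℓ₁ ℓ₂ ℓ₃`: `Φ(f, g ⊕ (ℓ₁ℓ₂ ⊕ ℓ₃)) = 1 ∨ Φ(f, g ⊕ (ℓ₁ℓ₂ ⊕ ℓ₃)) ≤ 31/32`
(`ar_rankTwoCeiling_of_derivDegree` applied to the landed derivative-degree lemma `stub_derivDegree`). -/
theorem ar_rankTwoCeiling : ∀ (m : ℕ) (f d g ℓ₁ ℓ₂ ℓ₃ : (Fin (m + m) → Bool) → Bool), IsDegLeFun 3 f → IsDegLeFun 3 d → (∀ x, W (fun y => signOf (g y)) x = (2 : ℝ) ^ m * signOf (d x)) → IsDegLeFun 1 ℓ₁ → IsDegLeFun 1 ℓ₂ → IsDegLeFun 1 ℓ₃ → forrelation f (fun y => g y ^^ ((ℓ₁ y && ℓ₂ y) ^^ ℓ₃ y)) = 1 ∨ forrelation f (fun y => g y ^^ ((ℓ₁ y && ℓ₂ y) ^^ ℓ₃ y)) ≤ 31 / 32 :=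
  ar_rankTwoCeiling_of_derivDegree stub_derivDegree

end Summit.QuantumAdvantage.QuantumAdvantage.Theorems.CubicForrelation.NearExactIsExact
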